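import Literature.MeasureTheory.Group.InvariantQuotientPiNormalized     -- ★ `subgroupPiCoords`, `subgroupPiHomeomorph`, `map_quotientPiHomeomorph_quotientMeasure_pi`, `integral_quotientMeasure_pi_eq_integral_pi`
import Literature.MeasureTheory.Group.InvariantQuotientProdNormalized   -- ★ `integral_quotientMeasure_prod_eq_integral_prod`, `isClosed_coe_prod`
import Literature.MeasureTheory.Group.InvariantQuotientTransport        -- ★ `cosetCongr`, `subgroupCongrHomeomorph`, `map_cosetCongr_quotientMeasure`
import HarnessLib

/-!
# Quotient measures by a subgroup that is a product over a finite index set times a WHOLE direct factor: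
# `(A × B) ⧸ M` with `M ↔ (Π_i M_i) × B` along `A ≃ₜ* Π_i G_i` — the constant-free change of variables and the factorisation of orbital integrals
(Folland, *A Course in Abstract Harmonic Analysis* (1995), §2.6 Thm. 2.49, (2.52); Gelbart, *Automorphic forms on adele groups* (1975), §10 (10.19);
Deitmar–Echterhoff (2014), Thm. 1.5.3)

Topic `MeasureTheory/Group`; namespace `Literature.MeasureTheory.Group`; THEOREMS ONLY (no definition, no instance visible to importers, no named fact,
no `sorry`).  The situation of the archimedean endoscopic group `H_∞ = U(Φ₂)(L⁺ ⊗ ℝ) × U(Φ₁)(L⁺ ⊗ ℝ)` of the hodgecm cell's line LH3 ((PROD-QUOT-H), crux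
`stmt-HodgeConjecture-24833`): a product group `A × B`, a place decomposition `eA : A ≃ₜ* Π_i G_i`, and a closed subgroup `M ≤ A × B` which is PLACEWISE in `A` and
contains the WHOLE factor `B` — `(a, b) ∈ M ↔ ∀ i, (eA a)_i ∈ M_i` (the chart torus `T_S = (Π_w T_{S,w}) × U(Φ₁)_∞`).  For product Haar measures
`νH = (eA⁻¹_* ⊗_i ν_i) ⊗ ν_B` and Haar measures `ρ_i` on the `M_i`, ONE Haar measure `ρ` on `M` (the transported product `(⊗_i ρ_i) ⊗ ν_B`, built here) makes
the canonical quotient measure ★ `quotientMeasure M ρ νH` (`InvariantQuotientExistence`) factor EXACTLY: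
* §1 `quotientMeasure_top_univ`, `integral_quotientMeasure_top` — the quotient of `ν` by `ν` itself on the one-point space `G ⧸ G` has mass `1`
  (Weil's formula with constant one, ★ `lintegral_fiberLIntegral_quotientMeasure`), so `∫_{G ⧸ G} F = F(pt)`.
* §2 `integral_prod_eq_of_subsingleton` (a probability measure on a one-point factor drops out of a product integral), `isInvInvariant_prod`.
* §3 **`exists_haar_quotientMeasure_prod_pi_top`** — THE PACKAGE: `∃ ρ` Haar and inversion invariant on `M` with
  (mass) `ρ {m | ∀ i, (eA m.1)_i ∈ K_i} = (Π_i ρ_i(K_i)) · ν_B(B)` for all `K_i ⊆ M_i`;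
  (change of variables, Banach-valued, NO integrability hypothesis) for `γ = (eA⁻¹ (γ_i)_i, b)` commuting with `M`,
  `∫_{(A×B)⧸M} F(y γ y⁻¹) d(νH∕ρ)(ȳ) = ∫_{Π_i (G_i ⧸ M_i)} F(eA⁻¹((x_i γ_i x_i⁻¹)_i), b) d(⊗_i ν_i∕ρ_i)` — the `B`-factor DISAPPEARS (it is inside `M`) and the
  `A`-factor is the product of the places (★ `map_cosetCongr_quotientMeasure` + ★ `integral_quotientMeasure_prod_eq_integral_prod` +
  ★ `integral_quotientMeasure_pi_eq_integral_pi`, all with constant `1`);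
  (product test functions) `F(a, b′) = (Π_i f_i((eA a)_i)) · g(b′)` ⟹ `∫ F(y γ y⁻¹) d(νH∕ρ) = g(b) · Π_i ∫_{G_i ⧸ M_i} f_i(x γ_i x⁻¹) d(ν_i∕ρ_i)` (Gelbart's (10.19)
  with its equality sign, in this shape).
HONEST LABEL: pure measure theory over the tree's quotient-measure kit; HC_CM is proved only modulo the printed citations until rung 0 closes and this file pays nothing by
itself.

## References
* [Folland1995] G. B. Folland, *A Course in Abstract Harmonic Analysis* (1995), §2.2, §2.6 Thm. 2.49, (2.52).
* [Gelbart1975] S. Gelbart, *Automorphic forms on adele groups*, Ann. of Math. Studies 83 (1975), §10, p. 155, (10.19).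
* [DeitmarEchterhoff2014] A. Deitmar, S. Echterhoff, *Principles of Harmonic Analysis*, 2nd ed. (2014), Thm. 1.5.3.
* [BorelJacquet1979] A. Borel, H. Jacquet, *Automorphic forms and automorphic representations*, PSPM 33.1 (1979), §4.1 (`G_∞ = Π_v G(F_v)`, product measures).
-/

set_option autoImplicit false

noncomputable section

open MeasureTheory MeasureTheory.Measure Topology
open scoped NNReal ENNReal

namespace Literature.MeasureTheory.Group

/-! ### §1 The quotient by the whole group -/

section Top

variable {G : Type*} [Group G] [TopologicalSpace G]

/-- `⊤ ≤ G` is closed (the whole group as a closed subgroup). [cite: Folland1995, §2.2] -/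
theorem isClosed_coe_top : IsClosed ((⊤ : Subgroup G) : Set G) := by
  rw [Subgroup.coe_top]; exact isClosed_univ

variable [IsTopologicalGroup G] [LocallyCompactSpace G] [SecondCountableTopology G] [T2Space G] [MeasurableSpace G] [BorelSpace G]
  (ν : Measure G) [IsHaarMeasure ν] [ν.IsMulRightInvariant]
  (ρ : Measure (⊤ : Subgroup G)) [ρ.IsMulLeftInvariant] [IsFiniteMeasureOnCompacts ρ] [ρ.IsOpenPosMeasure] [ρ.IsInvInvariant]
  (hρ : Measure.map ((⊤ : Subgroup G).subtype : (⊤ : Subgroup G) → G) ρ = ν)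
  [MeasurableSpace (G ⧸ (⊤ : Subgroup G))] [BorelSpace (G ⧸ (⊤ : Subgroup G))]

include hρ in
/-- **The quotient of `ν` by itself has mass one**: for the whole group `⊤ ≤ G` carrying (a copy `ρ` of) `ν`, the canonical quotient measure on the one-point space
`G ⧸ G` satisfies `(ν ∕ ρ)(G ⧸ G) = 1` — Weil's formula with constant one (★ `lintegral_fiberLIntegral_quotientMeasure`) tested on the indicator of a positive compact
`K`: the fibre integral is the constant `ν(K)`. [cite: DeitmarEchterhoff2014, Thm. 1.5.3] [cite: Folland1995, §2.6 (2.52)] -/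
theorem quotientMeasure_top_univ : quotientMeasure (⊤ : Subgroup G) ρ isClosed_coe_top ν Set.univ = 1 := by
  haveI : IsClosed ((⊤ : Subgroup G) : Set G) := isClosed_coe_top
  obtain ⟨K⟩ := (inferInstance : Nonempty (TopologicalSpace.PositiveCompacts G))
  have hKpos : 0 < ν K := measure_pos_of_nonempty_interior ν K.interior_nonempty
  have hKfin : ν K < ⊤ := K.isCompact.measure_lt_top
  have hf : Measurable ((K : Set G).indicator (1 : G → ℝ≥0∞)) := measurable_one.indicator K.isCompact.measurableSet
  have hfib : ∀ x : G ⧸ (⊤ : Subgroup G), fiberLIntegral (⊤ : Subgroup G) ρ ((K : Set G).indicator (1 : G → ℝ≥0∞)) x = ν K := by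
    intro x
    induction x using QuotientGroup.induction_on with
    | H g =>
      rw [fiberLIntegral_mk]
      have hsub : Measurable ((⊤ : Subgroup G).subtype : (⊤ : Subgroup G) → G) := continuous_subtype_val.measurable
      have h1 : ∫⁻ h : (⊤ : Subgroup G), (K : Set G).indicator (1 : G → ℝ≥0∞) (g * (h : G)) ∂ρ =
          ∫⁻ y, (K : Set G).indicator (1 : G → ℝ≥0∞) (g * y) ∂(Measure.map ((⊤ : Subgroup G).subtype : (⊤ : Subgroup G) → G) ρ) := by
        rw [lintegral_map (f := fun y => (K : Set G).indicator (1 : G → ℝ≥0∞) (g * y)) (hf.comp (measurable_const_mul g)) hsub]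
        rfl
      rw [h1, hρ, lintegral_mul_left_eq_self, lintegral_indicator_one K.isCompact.measurableSet]
  have hW := lintegral_fiberLIntegral_quotientMeasure (⊤ : Subgroup G) ρ ν hf
  simp_rw [hfib] at hW
  rw [lintegral_const, lintegral_indicator_one K.isCompact.measurableSet] at hW
  have h2 : ν K * quotientMeasure (⊤ : Subgroup G) ρ isClosed_coe_top ν Set.univ = ν K * 1 := by
    rw [mul_one]; exact hW
  exact (ENNReal.mul_right_inj hKpos.ne' hKfin.ne).mp h2

include hρ in
/-- **`∫_{G ⧸ G} F d(ν ∕ ρ) = F(pt)`** for every Banach-valued `F` (the space is one point and the mass is one). [cite: DeitmarEchterhoff2014, Thm. 1.5.3] -/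
theorem integral_quotientMeasure_top {E : Type*} [NormedAddCommGroup E] [NormedSpace ℝ E] [CompleteSpace E] (F : G ⧸ (⊤ : Subgroup G) → E) :
    ∫ x, F x ∂(quotientMeasure (⊤ : Subgroup G) ρ isClosed_coe_top ν) = F ((1 : G) : G ⧸ (⊤ : Subgroup G)) := by
  haveI : Subsingleton (G ⧸ (⊤ : Subgroup G)) := QuotientGroup.subsingleton_quotient_top
  have hF : F = fun _ => F ((1 : G) : G ⧸ (⊤ : Subgroup G)) := funext fun x => congrArg F (Subsingleton.elim _ _)
  rw [hF, integral_const, measureReal_def, quotientMeasure_top_univ ν ρ hρ, ENNReal.toReal_one, one_smul]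

end Top

/-! ### §2 Two small measure-theoretic helpers -/

section Helpers

/-- **A probability measure on a one-point factor drops out of a product integral**: `Y` a subsingleton, `ν(Y) = 1` ⟹ `∫_{X × Y} Φ d(μ ⊗ ν) = ∫_X Φ(x, y₀) dμ`
(`ν` is the Dirac mass; Mathlib `Measure.prod_dirac`). [cite: Folland1995, §2.6 (2.52)] -/
theorem integral_prod_eq_of_subsingleton {X Y : Type*} [MeasurableSpace X] [MeasurableSpace Y] [Subsingleton Y]
    (μ : Measure X) [SFinite μ] (ν : Measure Y) (hν : ν Set.univ = 1) (y₀ : Y)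
    {E : Type*} [NormedAddCommGroup E] [NormedSpace ℝ E] (Φ : X × Y → E) :
    ∫ p, Φ p ∂(μ.prod ν) = ∫ x, Φ (x, y₀) ∂μ := by
  have hν' : ν = Measure.dirac y₀ := by
    refine Measure.ext fun s _ => ?_
    by_cases h : y₀ ∈ s
    · have hs : s = Set.univ := Set.eq_univ_of_forall fun y => (Subsingleton.elim y₀ y) ▸ h
      rw [hs, hν, Measure.dirac_apply_of_mem (Set.mem_univ _)]
    · have hs : s = ∅ := by
        ext y
        exact ⟨fun hy => h ((Subsingleton.elim y y₀) ▸ hy), fun hy => hy.elim⟩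
      rw [hs, measure_empty, measure_empty]
  let e₀ : X × Y ≃ᵐ X :=
    { toFun := Prod.fst
      invFun := fun x => (x, y₀)
      left_inv := fun p => Prod.ext rfl (Subsingleton.elim _ _)
      right_inv := fun _ => rfl
      measurable_toFun := measurable_fst
      measurable_invFun := measurable_prodMk_right }
  rw [hν', Measure.prod_dirac, show (fun x : X => (x, y₀)) = ⇑e₀.symm from rfl, integral_map_equiv]
  rfl

/-- **The product of two inversion-invariant measures is inversion invariant** (`(μ ⊗ ν)⁻ = μ⁻ ⊗ ν⁻`, Mathlib `Measure.map_prod_map`; product Haar measures of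
unimodular groups). [cite: Folland1995, §2.6 Thm. 2.49] -/
theorem isInvInvariant_prod {X Y : Type*} [Group X] [Group Y] [MeasurableSpace X] [MeasurableSpace Y] [MeasurableInv X] [MeasurableInv Y]
    (μ : Measure X) (ν : Measure Y) [SFinite μ] [SFinite ν] [μ.IsInvInvariant] [ν.IsInvInvariant] : (μ.prod ν).IsInvInvariant := by
  refine ⟨?_⟩
  rw [Measure.inv_def, show (Inv.inv : X × Y → X × Y) = Prod.map Inv.inv Inv.inv from rfl,
    ← Measure.map_prod_map μ ν measurable_inv measurable_inv, Measure.map_inv_eq_self, Measure.map_inv_eq_self]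

variable {G G' : Type*} [Group G] [Group G'] [TopologicalSpace G] [TopologicalSpace G']
  [IsTopologicalGroup G] [IsTopologicalGroup G'] [MeasurableSpace G] [BorelSpace G] [MeasurableSpace G'] [BorelSpace G']
  (e : G ≃* G') (he : Continuous e) (hes : Continuous e.symm)
  (H : Subgroup G) (H' : Subgroup G') (hHH' : ∀ g, e g ∈ H' ↔ g ∈ H)

/-- A Haar measure on `H` transported along the restriction `H ≃ₜ H′` of `e` (★ `subgroupCongrHomeomorph`) is a Haar measure (the restriction is an isomorphism of
topological groups; Mathlib `MulEquiv.isHaarMeasure_map`). [folklore] -/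
private theorem isHaarMeasure_map_subgroupCongrHomeomorph' [LocallyCompactSpace H] (ρ : Measure H) [IsHaarMeasure ρ] :
    IsHaarMeasure (Measure.map (subgroupCongrHomeomorph e H H' hHH' he hes) ρ) := by
  let f : H ≃* H' :=
    { toFun := fun h => ⟨e h, (hHH' h).2 h.2⟩
      invFun := fun h' => ⟨e.symm h', (forall_symm_mem_iff e H H' hHH' h').2 h'.2⟩
      left_inv := fun h => Subtype.ext (e.symm_apply_apply h)
      right_inv := fun h' => Subtype.ext (e.apply_symm_apply h')
      map_mul' := fun a b => Subtype.ext (by simp only [Subgroup.coe_mul, map_mul]) }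
  have hf : ⇑f = ⇑(subgroupCongrHomeomorph e H H' hHH' he hes) := rfl
  have h := MulEquiv.isHaarMeasure_map ρ f (hf ▸ (subgroupCongrHomeomorph e H H' hHH' he hes).continuous)
    (by
      have : ⇑f.symm = ⇑(subgroupCongrHomeomorph e H H' hHH' he hes).symm := rfl
      rw [this]; exact (subgroupCongrHomeomorph e H H' hHH' he hes).symm.continuous)
  rwa [hf] at h

/-- … and inversion invariant when `ρ` is. [folklore] -/
private theorem isInvInvariant_map_subgroupCongrHomeomorph' (ρ : Measure H) [ρ.IsInvInvariant] :
    (Measure.map (subgroupCongrHomeomorph e H H' hHH' he hes) ρ).IsInvInvariant := by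
  let f : H ≃* H' :=
    { toFun := fun h => ⟨e h, (hHH' h).2 h.2⟩
      invFun := fun h' => ⟨e.symm h', (forall_symm_mem_iff e H H' hHH' h').2 h'.2⟩
      left_inv := fun h => Subtype.ext (e.symm_apply_apply h)
      right_inv := fun h' => Subtype.ext (e.apply_symm_apply h')
      map_mul' := fun a b => Subtype.ext (by simp only [Subgroup.coe_mul, map_mul]) }
  have hf : ⇑f = ⇑(subgroupCongrHomeomorph e H H' hHH' he hes) := rfl
  have h := isInvInvariant_map_mulEquiv f (hf ▸ (subgroupCongrHomeomorph e H H' hHH' he hes).continuous.measurable) ρ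
  rwa [hf] at h

end Helpers

/-! ### §3 The package: `(A × B) ⧸ M` with `M ↔ (Π_i M_i) × B` -/

section PiTop

variable {ι : Type*} [Fintype ι]
  {Gi : ι → Type*} [∀ i, Group (Gi i)] [∀ i, TopologicalSpace (Gi i)] [∀ i, IsTopologicalGroup (Gi i)]
  [∀ i, LocallyCompactSpace (Gi i)] [∀ i, SecondCountableTopology (Gi i)] [∀ i, T2Space (Gi i)]
  [∀ i, MeasurableSpace (Gi i)] [∀ i, BorelSpace (Gi i)]
  {A B : Type*} [Group A] [Group B] [TopologicalSpace A] [TopologicalSpace B]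
  [IsTopologicalGroup A] [IsTopologicalGroup B] [LocallyCompactSpace A] [LocallyCompactSpace B]
  [SecondCountableTopology A] [SecondCountableTopology B] [T2Space A] [T2Space B]
  [MeasurableSpace A] [BorelSpace A] [MeasurableSpace B] [BorelSpace B]
  (eA : A ≃ₜ* (∀ i, Gi i))
  (Mi : ∀ i, Subgroup (Gi i)) (hMi : ∀ i, IsClosed (Mi i : Set (Gi i)))
  (M : Subgroup (A × B)) (hM : IsClosed (M : Set (A × B)))
  (hmem : ∀ p : A × B, p ∈ M ↔ ∀ i, eA p.1 i ∈ Mi i)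
  (ρi : ∀ i, Measure (Mi i)) [∀ i, (ρi i).IsHaarMeasure] [∀ i, (ρi i).IsInvInvariant] [∀ i, SigmaFinite (ρi i)]
  (νi : ∀ i, Measure (Gi i)) [∀ i, IsHaarMeasure (νi i)] [∀ i, (νi i).IsMulRightInvariant]
  (νB : Measure B) [IsHaarMeasure νB] [νB.IsMulRightInvariant] [νB.IsInvInvariant]
  (νH : Measure (A × B)) [IsHaarMeasure νH] [νH.IsMulRightInvariant]
  (hν : νH = ((Measure.pi νi).map eA.symm).prod νB)
  [MeasurableSpace ((A × B) ⧸ M)] [BorelSpace ((A × B) ⧸ M)]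
  [∀ i, MeasurableSpace (Gi i ⧸ Mi i)] [∀ i, BorelSpace (Gi i ⧸ Mi i)]

include hMi hmem hν in
/-- **THE PACKAGE.**  `A × B` with a place decomposition `eA : A ≃ₜ* Π_i G_i`, a closed subgroup `M` with `(a, b) ∈ M ↔ ∀ i, (eA a)_i ∈ M_i` (placewise in `A`, ALL of
`B`), product Haar measures `νH = (eA⁻¹_* ⊗ ν_i) ⊗ ν_B`, Haar measures `ρ_i` on the closed `M_i`.  Then there is ONE inversion-invariant Haar measure `ρ` on `M` — the
transport of `(⊗_i ρ_i) ⊗ ν_B` — such that: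
(mass) `ρ {m | ∀ i, (eA m.1)_i ∈ K_i} = (Π_i ρ_i K_i) · ν_B(B)`;
(change of variables) for `γ = (eA⁻¹ γ_•, b)` commuting with `M` (and `γ_i` with `M_i`) and EVERY Banach-valued `F` (no integrability needed),
`∫_{(A×B)⧸M} F(y γ y⁻¹) d(νH∕ρ) = ∫_{Π_i G_i⧸M_i} F(eA⁻¹ (x_i γ_i x_i⁻¹)_i, b) d(⊗_i ν_i∕ρ_i)` — the factor `B ≤ M` drops out, the `A`-factor is the product over `i`;
(product test functions) `F(a, b′) = (Π_i f_i((eA a)_i))·g(b′)` ⟹ `∫ F(yγy⁻¹) d(νH∕ρ) = g(b) · Π_i ∫_{G_i⧸M_i} f_i(xγ_ix⁻¹) d(ν_i∕ρ_i)`.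
[cite: Folland1995, §2.6 Thm. 2.49, (2.52)] [cite: Gelbart1975, p. 155 (10.19)] [cite: DeitmarEchterhoff2014, Thm. 1.5.3] [cite: BorelJacquet1979, §4.1] -/
theorem exists_haar_quotientMeasure_prod_pi_top :
    ∃ (ρ : Measure M) (_ : ρ.IsHaarMeasure) (_ : ρ.IsInvInvariant),
      (∀ K : ∀ i, Set (Mi i),
        ρ {m : M | ∀ i, (⟨eA (m : A × B).1 i, (hmem _).1 m.2 i⟩ : Mi i) ∈ K i} = (∏ i, ρi i (K i)) * νB Set.univ) ∧
      (∀ (γi : ∀ i, Gi i) (b : B) (hγi : ∀ i, ∀ m ∈ Mi i, m * γi i = γi i * m)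
        (hγ : ∀ m ∈ M, m * (eA.symm γi, b) = (eA.symm γi, b) * m) (F : A × B → ℂ),
        ∫ y, descConj (eA.symm γi, b) M hγ F y ∂(quotientMeasure M ρ hM νH) =
          ∫ p, F (eA.symm (fun i => descConj (γi i) (Mi i) (hγi i) id (p i)), b)
            ∂(Measure.pi fun i => quotientMeasure (Mi i) (ρi i) (hMi i) (νi i))) ∧
      (∀ (γi : ∀ i, Gi i) (b : B) (hγi : ∀ i, ∀ m ∈ Mi i, m * γi i = γi i * m)
        (hγ : ∀ m ∈ M, m * (eA.symm γi, b) = (eA.symm γi, b) * m) (F : A × B → ℂ) (f : ∀ i, Gi i → ℂ) (g : B → ℂ)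
        (_hF : ∀ a b', F (a, b') = (∏ i, f i (eA a i)) * g b'),
        ∫ y, descConj (eA.symm γi, b) M hγ F y ∂(quotientMeasure M ρ hM νH) =
          g b * ∏ i, ∫ x, descConj (γi i) (Mi i) (hγi i) (f i) x ∂(quotientMeasure (Mi i) (ρi i) (hMi i) (νi i))) := by
  classical
  -- instances on the subgroups
  haveI : ∀ i, LocallyCompactSpace (Mi i) := fun i => (hMi i).isClosedEmbedding_subtypeVal.locallyCompactSpace
  haveI hMc : IsClosed (M : Set (A × B)) := hM
  haveI : LocallyCompactSpace M := hM.isClosedEmbedding_subtypeVal.locallyCompactSpace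
  haveI : ∀ i, IsClosed (Mi i : Set (Gi i)) := hMi
  -- the product-side isomorphism `e : (Π G_i) × B ≃* A × B`
  set e : (∀ i, Gi i) × B ≃* A × B := eA.symm.toMulEquiv.prodCongr (MulEquiv.refl B) with he_def
  have he_apply : ∀ p : (∀ i, Gi i) × B, e p = (eA.symm p.1, p.2) := fun p => rfl
  have he : Continuous e := (eA.symm.continuous.comp continuous_fst).prodMk continuous_snd
  have hes : Continuous e.symm := (eA.continuous.comp continuous_fst).prodMk continuous_snd
  -- the product-side subgroup `M' = (Π M_i) × ⊤`
  have hπc : IsClosed ((Subgroup.pi Set.univ Mi : Subgroup (∀ i, Gi i)) : Set (∀ i, Gi i)) := isClosed_coe_pi Mi hMi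
  haveI : IsClosed ((Subgroup.pi Set.univ Mi : Subgroup (∀ i, Gi i)) : Set (∀ i, Gi i)) := hπc
  haveI hTc : IsClosed ((⊤ : Subgroup B) : Set B) := isClosed_coe_top
  have hM'c : IsClosed (((Subgroup.pi Set.univ Mi).prod (⊤ : Subgroup B) : Subgroup ((∀ i, Gi i) × B)) : Set ((∀ i, Gi i) × B)) :=
    isClosed_coe_prod _ _ hπc hTc
  haveI : IsClosed (((Subgroup.pi Set.univ Mi).prod (⊤ : Subgroup B) : Subgroup ((∀ i, Gi i) × B)) : Set ((∀ i, Gi i) × B)) := hM'c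
  have hHH' : ∀ p : (∀ i, Gi i) × B, e p ∈ M ↔ p ∈ (Subgroup.pi Set.univ Mi).prod (⊤ : Subgroup B) := fun p => by
    rw [hmem, he_apply, Subgroup.mem_prod, Subgroup.mem_pi]
    simp only [ContinuousMulEquiv.apply_symm_apply, Set.mem_univ, forall_const, Subgroup.mem_top, and_true]
  -- Borel structures on the intermediate coset spaces
  letI : MeasurableSpace ((∀ i, Gi i) ⧸ Subgroup.pi Set.univ Mi) := borel _
  haveI : BorelSpace ((∀ i, Gi i) ⧸ Subgroup.pi Set.univ Mi) := ⟨rfl⟩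
  letI : MeasurableSpace (B ⧸ (⊤ : Subgroup B)) := borel _
  haveI : BorelSpace (B ⧸ (⊤ : Subgroup B)) := ⟨rfl⟩
  letI : MeasurableSpace (((∀ i, Gi i) × B) ⧸ (Subgroup.pi Set.univ Mi).prod (⊤ : Subgroup B)) := borel _
  haveI : BorelSpace (((∀ i, Gi i) × B) ⧸ (Subgroup.pi Set.univ Mi).prod (⊤ : Subgroup B)) := ⟨rfl⟩
  -- (a) the product torus measure on `Π M_i` (along `↥(Π M_i) ≃ₜ* Π ↥M_i`, ★ `subgroupPiCoords` ∕ `subgroupPiHomeomorph`)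
  let eπ : (Subgroup.pi Set.univ Mi) ≃ₜ* (∀ i, Mi i) :=
    { subgroupPiCoords Mi with
      continuous_toFun := (subgroupPiHomeomorph Mi).continuous
      continuous_invFun := (subgroupPiHomeomorph Mi).symm.continuous }
  have heπ : (⇑eπ : (Subgroup.pi Set.univ Mi) → ∀ i, Mi i) = subgroupPiCoords Mi := rfl
  set ρπ : Measure (Subgroup.pi Set.univ Mi) := (Measure.pi ρi).map eπ.symm with hρπ_def
  haveI : LocallyCompactSpace (Subgroup.pi Set.univ Mi) := hπc.isClosedEmbedding_subtypeVal.locallyCompactSpace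
  haveI : ρπ.IsHaarMeasure := eπ.symm.isHaarMeasure_map _
  haveI : ρπ.IsInvInvariant := isInvInvariant_map_mulEquiv eπ.symm.toMulEquiv eπ.symm.continuous.measurable _
  have hρπ : Measure.map (subgroupPiCoords Mi) ρπ = Measure.pi ρi := by
    rw [hρπ_def, ← heπ, Measure.map_map (show Measurable (⇑eπ : (Subgroup.pi Set.univ Mi) → ∀ i, Mi i) from eπ.continuous.measurable)
      (show Measurable (⇑eπ.symm : (∀ i, Mi i) → (Subgroup.pi Set.univ Mi)) from eπ.symm.continuous.measurable)]
    have : (⇑eπ : (Subgroup.pi Set.univ Mi) → ∀ i, Mi i) ∘ ⇑eπ.symm = id := funext fun x => eπ.apply_symm_apply x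
    rw [this, Measure.map_id]
  -- (b) `ν_B` on `⊤ ≤ B`
  let eT : (⊤ : Subgroup B) ≃ₜ* B :=
    { Subgroup.topEquiv with
      continuous_toFun := continuous_subtype_val
      continuous_invFun := continuous_id.subtype_mk _ }
  set ρT : Measure (⊤ : Subgroup B) := νB.map eT.symm with hρT_def
  haveI : LocallyCompactSpace (⊤ : Subgroup B) := hTc.isClosedEmbedding_subtypeVal.locallyCompactSpace
  haveI : ρT.IsHaarMeasure := eT.symm.isHaarMeasure_map _
  haveI : ρT.IsInvInvariant := isInvInvariant_map_mulEquiv eT.symm.toMulEquiv eT.symm.continuous.measurable _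
  have hρT : Measure.map ((⊤ : Subgroup B).subtype : (⊤ : Subgroup B) → B) ρT = νB := by
    rw [hρT_def, Measure.map_map (show Measurable ((⊤ : Subgroup B).subtype : (⊤ : Subgroup B) → B) from continuous_subtype_val.measurable)
      (show Measurable (⇑eT.symm : B → (⊤ : Subgroup B)) from eT.symm.continuous.measurable)]
    have : ((⊤ : Subgroup B).subtype : (⊤ : Subgroup B) → B) ∘ ⇑eT.symm = id := funext fun _ => rfl
    rw [this, Measure.map_id]
  have hρT_univ : ρT Set.univ = νB Set.univ := by
    rw [hρT_def, Measure.map_apply (show Measurable (⇑eT.symm : B → (⊤ : Subgroup B)) from eT.symm.continuous.measurable) MeasurableSet.univ,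
      Set.preimage_univ]
  -- (c) the product measure on `M' = (Π M_i) × ⊤` (along `↥(H × K) ≃ₜ* ↥H × ↥K`, Mathlib `Subgroup.prodEquiv`)
  let ep : ((Subgroup.pi Set.univ Mi).prod (⊤ : Subgroup B)) ≃ₜ* (Subgroup.pi Set.univ Mi) × (⊤ : Subgroup B) :=
    { Subgroup.prodEquiv (Subgroup.pi Set.univ Mi) (⊤ : Subgroup B) with
      continuous_toFun := ((continuous_fst.comp continuous_subtype_val).subtype_mk _).prodMk ((continuous_snd.comp continuous_subtype_val).subtype_mk _)
      continuous_invFun := ((continuous_subtype_val.comp continuous_fst).prodMk (continuous_subtype_val.comp continuous_snd)).subtype_mk _ }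
  have hep : (⇑ep : _ → _) = Subgroup.prodEquiv (Subgroup.pi Set.univ Mi) (⊤ : Subgroup B) := rfl
  set ρp : Measure ((Subgroup.pi Set.univ Mi).prod (⊤ : Subgroup B)) := (ρπ.prod ρT).map ep.symm with hρp_def
  haveI : (ρπ.prod ρT).IsInvInvariant := isInvInvariant_prod ρπ ρT
  haveI : LocallyCompactSpace ((Subgroup.pi Set.univ Mi).prod (⊤ : Subgroup B)) := hM'c.isClosedEmbedding_subtypeVal.locallyCompactSpace
  haveI : ρp.IsHaarMeasure := ep.symm.isHaarMeasure_map _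
  haveI : ρp.IsInvInvariant := isInvInvariant_map_mulEquiv ep.symm.toMulEquiv ep.symm.continuous.measurable _
  have hρp : Measure.map (Subgroup.prodEquiv (Subgroup.pi Set.univ Mi) (⊤ : Subgroup B)) ρp = ρπ.prod ρT := by
    rw [hρp_def, ← hep, Measure.map_map (show Measurable (⇑ep : ((Subgroup.pi Set.univ Mi).prod (⊤ : Subgroup B)) → (Subgroup.pi Set.univ Mi) × (⊤ : Subgroup B)) from ep.continuous.measurable)
      (show Measurable (⇑ep.symm : (Subgroup.pi Set.univ Mi) × (⊤ : Subgroup B) → ((Subgroup.pi Set.univ Mi).prod (⊤ : Subgroup B))) from ep.symm.continuous.measurable)]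
    have : (⇑ep : _ → _) ∘ ⇑ep.symm = id := funext fun x => ep.apply_symm_apply x
    rw [this, Measure.map_id]
  -- (d) the transported measure on `M`
  set ρ : Measure M := ρp.map (subgroupCongrHomeomorph e _ M hHH' he hes) with hρ_def
  haveI hρH : ρ.IsHaarMeasure := isHaarMeasure_map_subgroupCongrHomeomorph' e he hes _ M hHH' ρp
  haveI hρI : ρ.IsInvInvariant := isInvInvariant_map_subgroupCongrHomeomorph' e he hes _ M hHH' ρp
  -- (e) the Haar measure on `A × B` in product coordinates
  have hν' : νH = Measure.map e ((Measure.pi νi).prod νB) := by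
    rw [hν]
    have h1 : (⇑e : (∀ i, Gi i) × B → A × B) = Prod.map eA.symm id := funext fun p => rfl
    rw [h1, ← Measure.map_prod_map _ _ (show Measurable (⇑eA.symm : (∀ i, Gi i) → A) from eA.symm.continuous.measurable) measurable_id, Measure.map_id]
  -- the transport identity for the quotient measures
  have hT := map_cosetCongr_quotientMeasure e he hes ((Subgroup.pi Set.univ Mi).prod (⊤ : Subgroup B)) M hHH' ρp ρ ((Measure.pi νi).prod νB) νH rfl hν'
  -- the change of variables (shared by both integral clauses)
  have hgen : ∀ (γi : ∀ i, Gi i) (b : B) (hγi : ∀ i, ∀ m ∈ Mi i, m * γi i = γi i * m)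
      (hγ : ∀ m ∈ M, m * (eA.symm γi, b) = (eA.symm γi, b) * m) (F : A × B → ℂ),
      ∫ y, descConj (eA.symm γi, b) M hγ F y ∂(quotientMeasure M ρ hM νH) =
        ∫ p, F (eA.symm (fun i => descConj (γi i) (Mi i) (hγi i) id (p i)), b)
          ∂(Measure.pi fun i => quotientMeasure (Mi i) (ρi i) (hMi i) (νi i)) := by
    intro γi b hγi hγ F
    -- `(γ_•, b)` commutes with `M'`
    have hγ' : ∀ m ∈ (Subgroup.pi Set.univ Mi).prod (⊤ : Subgroup B), m * (γi, b) = (γi, b) * m := by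
      intro m hm
      apply e.injective
      rw [map_mul, map_mul]
      exact hγ (e m) ((hHH' m).2 hm)
    -- step 1: transport to `((Π G_i) × B) ⧸ M'`
    have h1 : ∫ y, descConj (eA.symm γi, b) M hγ F y ∂(quotientMeasure M ρ hM νH) =
        ∫ z, descConj ((γi, b) : (∀ i, Gi i) × B) ((Subgroup.pi Set.univ Mi).prod (⊤ : Subgroup B)) hγ' (F ∘ e) z
          ∂(quotientMeasure ((Subgroup.pi Set.univ Mi).prod (⊤ : Subgroup B)) ρp hM'c ((Measure.pi νi).prod νB)) := by
      rw [← hT, ← coe_cosetCongrHomeomorph e _ M hHH' he hes, ← Homeomorph.toMeasurableEquiv_coe, integral_map_equiv]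
      refine integral_congr_ae (Filter.Eventually.of_forall fun z => ?_)
      induction z using QuotientGroup.induction_on with
      | H y =>
        simp only [Homeomorph.toMeasurableEquiv_coe, coe_cosetCongrHomeomorph, cosetCongr_mk, descConj_mk, Function.comp_apply, map_mul, map_inv]
        rfl
    -- step 2: the binary split `M' = (Π M_i) × ⊤`
    have h2 := integral_quotientMeasure_prod_eq_integral_prod (Subgroup.pi Set.univ Mi) (⊤ : Subgroup B) ρπ ρT ρp hρp (Measure.pi νi) νB
      (fun z => descConj ((γi, b) : (∀ i, Gi i) × B) ((Subgroup.pi Set.univ Mi).prod (⊤ : Subgroup B)) hγ' (F ∘ e) z)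
    -- step 3: the `⊤`-factor is a one-point probability space
    haveI : Subsingleton (B ⧸ (⊤ : Subgroup B)) := QuotientGroup.subsingleton_quotient_top
    have h3 := integral_prod_eq_of_subsingleton (quotientMeasure (Subgroup.pi Set.univ Mi) ρπ hπc (Measure.pi νi))
      (quotientMeasure (⊤ : Subgroup B) ρT hTc νB) (quotientMeasure_top_univ νB ρT hρT) ((1 : B) : B ⧸ (⊤ : Subgroup B))
      (fun p => descConj ((γi, b) : (∀ i, Gi i) × B) ((Subgroup.pi Set.univ Mi).prod (⊤ : Subgroup B)) hγ' (F ∘ e)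
        ((QuotientGroup.prodEquiv (Subgroup.pi Set.univ Mi) (⊤ : Subgroup B)).symm p))
    -- step 4: the finite product
    have h4 := integral_quotientMeasure_pi_eq_integral_pi Mi hMi ρi ρπ hρπ νi
      (fun x => descConj ((γi, b) : (∀ i, Gi i) × B) ((Subgroup.pi Set.univ Mi).prod (⊤ : Subgroup B)) hγ' (F ∘ e)
        ((QuotientGroup.prodEquiv (Subgroup.pi Set.univ Mi) (⊤ : Subgroup B)).symm (x, ((1 : B) : B ⧸ (⊤ : Subgroup B)))))
    rw [h1, h2, h3, h4]
    -- step 5: the integrand in coordinates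
    refine integral_congr_ae (Filter.Eventually.of_forall fun p => ?_)
    have hp : p = fun i => (QuotientGroup.mk (p i).out : Gi i ⧸ Mi i) := funext fun i => (QuotientGroup.out_eq' (p i)).symm
    simp only []
    rw [hp, coe_quotientPiHomeomorph_symm, quotientPiEquiv_symm_mk, prodEquiv_symm_mk, descConj_mk, Function.comp_apply, he_apply]
    simp only [Prod.mk_mul_mk, Prod.inv_mk, one_mul, inv_one, mul_one, descConj_mk]
    rfl
  refine ⟨ρ, hρH, hρI, ?_, hgen, ?_⟩
  · -- (mass)
    intro K
    have hS : ρ {m : M | ∀ i, (⟨eA (m : A × B).1 i, (hmem _).1 m.2 i⟩ : Mi i) ∈ K i} =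
        (ρπ.prod ρT) ({x : Subgroup.pi Set.univ Mi | ∀ i, (⟨((x : ∀ i, Gi i) i), (Subgroup.mem_pi _).1 x.2 i (Set.mem_univ i)⟩ : Mi i) ∈ K i} ×ˢ Set.univ) := by
      rw [hρ_def, ← Homeomorph.toMeasurableEquiv_coe, MeasurableEquiv.map_apply, hρp_def,
        show Measure.map (⇑ep.symm) (ρπ.prod ρT) = Measure.map (⇑ep.symm.toHomeomorph.toMeasurableEquiv) (ρπ.prod ρT) from rfl, MeasurableEquiv.map_apply]
      congr 1
      ext x
      simp only [Set.mem_preimage, Set.mem_setOf_eq, Set.mem_prod, Set.mem_univ, and_true, Homeomorph.toMeasurableEquiv_coe]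
      refine forall_congr' fun i => ?_
      have hx : eA ((subgroupCongrHomeomorph e _ M hHH' he hes (ep.symm.toHomeomorph x) : M) : A × B).1 i =
          ((x.1 : Subgroup.pi Set.univ Mi) : ∀ i, Gi i) i := by
        rw [coe_subgroupCongrHomeomorph_apply, he_apply]
        simp only [ContinuousMulEquiv.apply_symm_apply]
        rfl
      exact ⟨fun h => by convert h using 1; exact Subtype.ext hx.symm, fun h => by convert h using 1; exact Subtype.ext hx⟩
    rw [hS, Measure.prod_prod, hρT_univ, hρπ_def,
      show Measure.map (⇑eπ.symm) (Measure.pi ρi) = Measure.map (⇑eπ.symm.toHomeomorph.toMeasurableEquiv) (Measure.pi ρi) from rfl, MeasurableEquiv.map_apply]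
    congr 1
    have hset : ⇑(eπ.symm.toHomeomorph.toMeasurableEquiv) ⁻¹'
        {x : Subgroup.pi Set.univ Mi | ∀ i, (⟨((x : ∀ i, Gi i) i), (Subgroup.mem_pi _).1 x.2 i (Set.mem_univ i)⟩ : Mi i) ∈ K i} = Set.pi Set.univ K := by
      ext y
      simp only [Set.mem_preimage, Set.mem_setOf_eq, Set.mem_pi, Set.mem_univ, forall_const, Homeomorph.toMeasurableEquiv_coe]
      refine forall_congr' fun i => ?_
      rfl
    rw [hset, Measure.pi_pi]
  · -- (product test functions)
    intro γi b hγi hγ F f g hF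
    rw [hgen γi b hγi hγ F]
    have hint : ∀ p : ∀ i, Gi i ⧸ Mi i, F (eA.symm (fun i => descConj (γi i) (Mi i) (hγi i) id (p i)), b) =
        (∏ i, descConj (γi i) (Mi i) (hγi i) (f i) (p i)) * g b := by
      intro p
      rw [hF, ContinuousMulEquiv.apply_symm_apply]
      congr 1
      refine Finset.prod_congr rfl fun i _ => ?_
      rw [descConj_eq_comp (γi i) (Mi i) (hγi i) (f i)]
      rfl
    simp_rw [hint]
    haveI : ∀ i, SigmaFinite (quotientMeasure (Mi i) (ρi i) (hMi i) (νi i)) := fun i => inferInstance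
    rw [integral_mul_const, integral_fintype_prod_eq_prod, mul_comm]

end PiTop

end Literature.MeasureTheory.Group

end
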